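import Mathlib.Data.Sym.Card
import Mathlib.Data.Finsupp.Multiset
import Mathlib.RingTheory.KrullDimension.Polynomial
import Mathlib.RingTheory.KrullDimension.Field
import Mathlib.FieldTheory.IsAlgClosed.AlgebraicClosure
import Literature.NumberTheory.Transcendental.RoySmallValueEstimatesResultantDegreeProofs
import Literature.NumberTheory.Transcendental.NesterenkoEliminationK
import Literature.NumberTheory.Transcendental.NesterenkoEliminationZerosGeneric
import Literature.NumberTheory.Transcendental.NesterenkoEliminationProp44K
import Literature.RingTheory.KrullDimension.AffineDimension
import HarnessLib

/-!
# Small value estimates at rational translates (Nguyen–Roy 2016) — proofs, XIV: `Res_D` over an arbitrary field of characteristic zero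

Fourteenth proofs file towards `Literature.NumberTheory.Transcendental.nguyenRoy2016_thm_1` (Nguyen–Roy,
IJNT 12 (2016) = arXiv:1412.5163). Files XI–XII constructed the resultant `Res_D` of `m + 1` forms of
degree `D` in `m + 1` variables over `ℚ` (`NguyenRoy.resD`) by transporting Nesterenko's elimination
theory along the Veronese map. Roy's multiplicity estimate (Mathematika 59 (2013) =
arXiv:1301.0663, Theorem 5.2) is applied to ideals `I ⊂ ℂ[X]` generated by forms with COMPLEX
coefficients, and its proof divides a determinant `Φ ∈ ℂ[u]` by the resultant; this needs the
resultant and its irreducibility over the field of definition of `Φ`. Exactly as the tree re-issues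
Nesterenko's Ch. 3 §4 over an arbitrary field (`NesterenkoK.*`: `NesterenkoEliminationK`,
`NesterenkoEliminationProp44K` = Prop. 4.4 over any field of characteristic zero,
`NesterenkoEliminationZerosGeneric` = the zeros theorem with zeros in an algebraically closed
extension), this file re-issues files XI–XII **over an arbitrary field `K` of characteristic zero**,
verbatim with `ℚ ↦ K`, `ℂ ↦ L` (`L ⊇ K` a field, algebraically closed where zeros are needed),
`Nesterenko ↦ NesterenkoK`; the field-independent combinatorics (`NguyenRoy.MonoIdx`, `veroN`,
`vexp`, `vidx`, `vsum`, `shiftIdx`, `exists_digits`, …) is reused, not re-issued: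

* `NguyenRoyK.veronese K m D`, `NguyenRoyK.veroIdeal K m D` (prime, homogeneous, of rank `m + 1`),
  `NguyenRoyK.veroPt`, `aeval_veroPt_eq_zero`, `exists_veroPt_of_zeros` (`V_L(𝔙_D) = v_D(ℙ^m(L))`);
* `NguyenRoyK.resD K m D := NesterenkoK.chowForm (veroIdeal K m D) (m + 1)`: `span_resD`,
  `irreducible_resD`, `blockDeg_resD`, and the zeros theorem `aeval_resD_eq_zero_iff` (over an
  algebraically closed `L ⊇ K`), for `char K = 0`, `m ≥ 1`, `D ≥ 2`;
* `NguyenRoyK.pow_le_ideg_veroIdeal : D^m ≤ deg 𝔙_D` (the pencil of file XII over `K`).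

For `K = ℚ` these are the objects of files XI–XII (`NesterenkoK.chowForm = Nesterenko.chowForm`
definitionally, `NesterenkoEliminationK.lean`). No named facts.

## References

* [Roy2013] D. Roy, *A small value estimate for 𝔾ₐ × 𝔾ₘ*, Mathematika 59 (2013) = arXiv:1301.0663,
  §5, Theorem 5.2 and its proof (the resultant in degree `D`, over `ℂ`).
* [NesterenkoPhilippon2001] Yu. V. Nesterenko, P. Philippon (eds.), LNM 1752 (2001), Ch. 3 §4,
  Def. 4.3–4.5, Prop. 4.4 (p. 38); Ch. 10 §2 (p. 153: the theory over a general field).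
* [NguyenRoy2016] N. A. V. Nguyen, D. Roy, IJNT 12 (2016) = arXiv:1412.5163, §4.
-/

noncomputable section

open MvPolynomial Finset

attribute [local instance] MvPolynomial.gradedAlgebra

namespace Literature.NumberTheory.Transcendental

namespace NguyenRoyK

open NguyenRoy (MonoIdx monoIdxEquivSym fintypeMonoIdx card_monoIdx veroN veroN_succ veroEquiv vexp
  degree_vexp vidx vexp_vidx vexp_injective vsum degree_vsum sum_smul_single_eq degree_shiftExp
  shiftIdx vexp_shiftIdx shiftIdx_self sum_smul_shiftExp_eq succ_le_veroN exists_digits)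

attribute [local instance] NguyenRoy.fintypeMonoIdx

variable (K : Type*) [Field K] (m D : ℕ)

section Veronese

variable {L : Type*} [Field L] [Algebra K L]

/-! ## The Veronese ring map `θ_D : K[y₀, …, y_N] → K[x₀, …, x_m]`, `yᵢ ↦ x^{αᵢ}` -/

/-- **The Veronese map** `θ_D(yᵢ) = x^{αᵢ}`. [folklore] -/
def veronese : MvPolynomial (Fin (veroN m D + 1)) K →ₐ[K] MvPolynomial (Fin (m + 1)) K :=
  aeval fun i => monomial (vexp m D i) (1 : K)

/-- `θ_D(yᵢ) = x^{αᵢ}`. [folklore] -/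
@[simp] theorem veronese_X (i : Fin (veroN m D + 1)) :
    veronese K m D (X i) = monomial (vexp m D i) 1 :=
  aeval_X _ i

/-- `θ_D` on monomials: `θ_D(c y^β) = c x^{∑ᵢ βᵢ αᵢ}`. [folklore] -/
theorem veronese_monomial (β : Fin (veroN m D + 1) →₀ ℕ) (c : K) :
    veronese K m D (monomial β c) = monomial (vsum m D β) c := by
  rw [veronese, aeval_monomial, Finsupp.prod, vsum, monomial_sum_index,
    Algebra.algebraMap_eq_smul_one, ← C_eq_smul_one]
  congr 1
  refine Finset.prod_congr rfl fun i _ => ?_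
  rw [monomial_pow, one_pow]

variable {K} in
/-- The degree of an exponent in the support of a form. [folklore] -/
theorem degree_eq_of_mem_support {σ : Type*} {F : MvPolynomial σ K} {n : ℕ}
    (hF : F.IsHomogeneous n) {d : σ →₀ ℕ} (hd : d ∈ F.support) : d.degree = n := by
  by_contra h
  exact (mem_support_iff.mp hd) (hF.coeff_eq_zero h)

/-- `θ_D` maps forms of degree `n` to forms of degree `D n`. [folklore] -/
theorem isHomogeneous_veronese {F : MvPolynomial (Fin (veroN m D + 1)) K} {n : ℕ} (hF : F.IsHomogeneous n) :
    (veronese K m D F).IsHomogeneous (D * n) := by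
  classical
  rw [← MvPolynomial.support_sum_monomial_coeff F, map_sum]
  refine MvPolynomial.IsHomogeneous.sum _ _ _ fun β hβ => ?_
  rw [veronese_monomial]
  exact isHomogeneous_monomial _ (by rw [degree_vsum, degree_eq_of_mem_support hF hβ])

variable {K m D} in
/-- **`θ_D` and homogeneous components**: `θ_D(F_n) = θ_D(F)_{Dn}` (`D ≥ 1`). [folklore] -/
theorem veronese_homogeneousComponent (hD : 1 ≤ D) (F : MvPolynomial (Fin (veroN m D + 1)) K) (n : ℕ) :
    veronese K m D (homogeneousComponent n F) = homogeneousComponent (D * n) (veronese K m D F) := by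
  classical
  induction F using MvPolynomial.induction_on' with
  | monomial β c =>
    rw [homogeneousComponent_of_mem (isHomogeneous_monomial c rfl : monomial β c ∈ _),
      veronese_monomial,
      homogeneousComponent_of_mem (isHomogeneous_monomial c rfl : monomial (vsum m D β) c ∈ _),
      degree_vsum]
    by_cases h : n = β.degree
    · rw [if_pos h, if_pos (by rw [h]), veronese_monomial]
    · rw [if_neg h, if_neg, map_zero]
      intro h'
      exact h (Nat.eq_of_mul_eq_mul_left (by omega) h')
  | add p q hp hq => rw [map_add, map_add, hp, hq, map_add, map_add]

/-! ## The Veronese ideal -/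

/-- **The Veronese ideal** `𝔙_D = ker θ_D ⊂ ℚ[y₀, …, y_N]`, the ideal of the Veronese variety
`v_D(ℙ^m) ⊂ ℙ^N`. [folklore] -/
def veroIdeal : Ideal (MvPolynomial (Fin (veroN m D + 1)) K) := RingHom.ker (veronese K m D)

/-- `𝔙_D` is prime (`ℚ[y]/𝔙_D` embeds in the domain `ℚ[x]`). [folklore] -/
theorem veroIdeal_isPrime : (veroIdeal K m D).IsPrime := RingHom.ker_isPrime _

/-- Membership in `𝔙_D`. [folklore] -/
theorem mem_veroIdeal_iff (F : MvPolynomial (Fin (veroN m D + 1)) K) : F ∈ veroIdeal K m D ↔ veronese K m D F = 0 :=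
  RingHom.mem_ker

variable {K m D} in
/-- `F ∈ 𝔙_D` iff all its homogeneous components are (`D ≥ 1`). [folklore] -/
theorem mem_veroIdeal_iff_forall (hD : 1 ≤ D) (F : MvPolynomial (Fin (veroN m D + 1)) K) :
    F ∈ veroIdeal K m D ↔ ∀ n, homogeneousComponent n F ∈ veroIdeal K m D := by
  classical
  constructor
  · intro h n
    rw [mem_veroIdeal_iff] at h ⊢
    rw [veronese_homogeneousComponent hD, h, map_zero]
  · intro h
    rw [← sum_homogeneousComponent F]
    exact Ideal.sum_mem _ fun n _ => h n

variable {K m D} in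
/-- **`𝔙_D` is a homogeneous ideal** (`D ≥ 1`). [folklore] -/
theorem veroIdeal_isHomogeneous (hD : 1 ≤ D) :
    (veroIdeal K m D).IsHomogeneous (homogeneousSubmodule (Fin (veroN m D + 1)) K) := by
  intro i F hF
  have e : (DirectSum.decompose (homogeneousSubmodule (Fin (veroN m D + 1)) K) F i :
      MvPolynomial (Fin (veroN m D + 1)) K) = homogeneousComponent i F :=
    weightedDecomposition.decompose'_apply K (1 : Fin (veroN m D + 1) → ℕ) F i
  rw [e]
  exact (mem_veroIdeal_iff_forall hD F).mp hF i

/-- `𝔙_D ≠ ⊤`. [folklore] -/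
theorem veroIdeal_ne_top : veroIdeal K m D ≠ ⊤ := (veroIdeal_isPrime K m D).ne_top

/-! ## Veronese points and the zeros of `𝔙_D` -/

/-- **The Veronese point** `v_D(x) = (x^{αᵢ})_{i ≤ N} ∈ L^{N+1}` of `x ∈ L^{m+1}`. [folklore] -/
def veroPt (x : Fin (m + 1) → L) : Fin (veroN m D + 1) → L := fun i => ∏ k, x k ^ vexp m D i k

/-- Evaluating a monomial with coefficient `1`. [folklore] -/
theorem aeval_monomial_one {σ : Type*} [Fintype σ] (x : σ → L) (s : σ →₀ ℕ) :
    aeval x (monomial s (1 : K)) = ∏ k, x k ^ s k := by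
  rw [aeval_monomial, map_one, one_mul, Finsupp.prod_fintype]
  intro k
  rw [pow_zero]

/-- **`F(v_D(x)) = θ_D(F)(x)`**. [folklore] -/
theorem aeval_veroPt (x : Fin (m + 1) → L) (F : MvPolynomial (Fin (veroN m D + 1)) K) :
    aeval (veroPt m D x) F = aeval x (veronese K m D F) := by
  have key : (aeval (veroPt m D x) : MvPolynomial (Fin (veroN m D + 1)) K →ₐ[K] L) =
      (aeval x).comp (veronese K m D) := by
    refine MvPolynomial.algHom_ext fun i => ?_
    rw [AlgHom.comp_apply, veronese_X, aeval_X, aeval_monomial_one]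
    rfl
  exact congrArg (fun φ : MvPolynomial (Fin (veroN m D + 1)) K →ₐ[K] L => φ F) key

/-- The coordinate of `v_D(x)` at the pure power `x_k^D` is `x_k^D`. [folklore] -/
theorem veroPt_vidx_single (x : Fin (m + 1) → L) (k : Fin (m + 1)) :
    veroPt m D x (vidx m D (Finsupp.single k D) (Finsupp.degree_single k D)) = x k ^ D := by
  rw [veroPt, vexp_vidx, Finset.prod_eq_single k]
  · rw [Finsupp.single_eq_same]
  · intro j _ hj
    rw [Finsupp.single_eq_of_ne hj, pow_zero]
  · intro h
    exact absurd (Finset.mem_univ k) h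

variable {K m D} in
/-- `v_D(x) ≠ 0` for `x ≠ 0`. [folklore] -/
theorem veroPt_ne_zero {x : Fin (m + 1) → L} (hx : x ≠ 0) : veroPt m D x ≠ 0 := by
  obtain ⟨k, hk⟩ := Function.ne_iff.mp hx
  intro h
  have := congrFun h (vidx m D (Finsupp.single k D) (Finsupp.degree_single k D))
  rw [veroPt_vidx_single, Pi.zero_apply] at this
  exact hk (pow_eq_zero_iff'.mp this).1

variable {K m D} in
/-- **Veronese points are zeros of the Veronese ideal**: `F(v_D(x)) = 0` for `F ∈ 𝔙_D`. [folklore] -/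
theorem aeval_veroPt_eq_zero (x : Fin (m + 1) → L) {F : MvPolynomial (Fin (veroN m D + 1)) K}
    (hF : F ∈ veroIdeal K m D) : aeval (veroPt m D x) F = 0 := by
  rw [aeval_veroPt, (mem_veroIdeal_iff K m D F).mp hF, map_zero]

/-! ### The quadratic-type relations in `𝔙_D` and the converse -/

variable {K m D} in
/-- The relation **`y_α^D − ∏_k y_{De_k}^{α_k} ∈ 𝔙_D`** (`θ_D` of both terms is `x^{Dα}`). [folklore] -/
theorem pow_sub_prod_mem_veroIdeal (i : Fin (veroN m D + 1)) :
    X i ^ D - ∏ k, X (vidx m D (Finsupp.single k D) (Finsupp.degree_single k D)) ^ vexp m D i k ∈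
      veroIdeal K m D := by
  rw [mem_veroIdeal_iff, map_sub, sub_eq_zero, map_pow, veronese_X, monomial_pow, one_pow, map_prod]
  simp_rw [map_pow, veronese_X, vexp_vidx, monomial_pow, one_pow]
  rw [← monomial_sum_one, sum_smul_single_eq]

variable {K m D} in
/-- The relation **`y_{De_k}^{D−1} y_α − ∏_j y_{(D−1)e_k+e_j}^{α_j} ∈ 𝔙_D`** (`θ_D` of both terms
is `x^{(D−1)D e_k + α}`). [folklore] -/
theorem pow_mul_sub_prod_mem_veroIdeal (hD : 1 ≤ D) (k : Fin (m + 1)) (i : Fin (veroN m D + 1)) :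
    X (vidx m D (Finsupp.single k D) (Finsupp.degree_single k D)) ^ (D - 1) * X i -
        ∏ j, X (shiftIdx hD k j) ^ vexp m D i j ∈ veroIdeal K m D := by
  rw [mem_veroIdeal_iff, map_sub, sub_eq_zero, map_mul, map_pow, veronese_X, veronese_X, vexp_vidx,
    monomial_pow, one_pow, monomial_mul, one_mul, map_prod]
  simp_rw [map_pow, veronese_X, vexp_shiftIdx hD, monomial_pow, one_pow]
  rw [← monomial_sum_one, sum_smul_shiftExp_eq]

variable {K m D} in
/-- **Every zero of `𝔙_D` is a Veronese point**: if `y ∈ L^{N+1} ∖ 0` kills `𝔙_D` then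
`c • y = v_D(x)` for some `x ≠ 0` and `c ≠ 0` (`D ≥ 1`). With `aeval_veroPt_eq_zero`:
`V_L(𝔙_D) = v_D(ℙ^m(L))` for every field `L ⊇ K`. [folklore] -/
theorem exists_veroPt_of_zeros (hD : 1 ≤ D) {y : Fin (veroN m D + 1) → L} (hy0 : y ≠ 0)
    (hyI : ∀ P ∈ veroIdeal K m D, aeval y P = 0) :
    ∃ x : Fin (m + 1) → L, x ≠ 0 ∧ ∃ c : L, c ≠ 0 ∧ c • y = veroPt m D x := by
  -- the pure powers
  set p : Fin (m + 1) → L := fun k => y (vidx m D (Finsupp.single k D) (Finsupp.degree_single k D))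
    with hp
  -- (E1) `y_i^D = ∏_k p_k^{α_i k}`
  have E1 : ∀ i, y i ^ D = ∏ k, p k ^ vexp m D i k := by
    intro i
    have h := hyI _ (pow_sub_prod_mem_veroIdeal i)
    simp only [map_sub, map_pow, map_prod, aeval_X, sub_eq_zero] at h
    exact h
  -- some pure power coordinate is non-zero
  obtain ⟨k, hk⟩ : ∃ k, p k ≠ 0 := by
    by_contra hall
    push Not at hall
    apply hy0
    funext i
    have h1 : ∃ k₀, vexp m D i k₀ ≠ 0 := by
      have hdeg : ∑ j, vexp m D i j = D := by
        rw [← Finsupp.degree_eq_sum]; exact degree_vexp m D i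
      by_contra hnone
      push Not at hnone
      rw [Finset.sum_eq_zero fun j _ => hnone j] at hdeg
      omega
    obtain ⟨k₀, hk₀⟩ := h1
    have h2 : y i ^ D = 0 := by
      rw [E1 i]
      exact Finset.prod_eq_zero (Finset.mem_univ k₀) (by rw [hall k₀, zero_pow hk₀])
    exact pow_eq_zero_iff (by omega) |>.mp h2
  -- the point `x` and the scalar `c`
  refine ⟨fun j => y (shiftIdx hD k j), ?_, p k ^ (D - 1), pow_ne_zero _ hk, ?_⟩
  · intro hx
    have := congrFun hx k
    rw [Pi.zero_apply, shiftIdx_self hD k] at this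
    exact hk this
  · funext i
    have h := hyI _ (pow_mul_sub_prod_mem_veroIdeal hD k i)
    simp only [map_sub, map_mul, map_pow, map_prod, aeval_X, sub_eq_zero] at h
    rw [Pi.smul_apply, smul_eq_mul]
    exact h

/-! ## The rank of `𝔙_D`: `dim ℚ[y]/𝔙_D = m + 1` -/

/-- `x_k^D = θ_D(y_{De_k})` lies in the Veronese subring. [folklore] -/
theorem X_pow_mem_range (k : Fin (m + 1)) : (X k : MvPolynomial (Fin (m + 1)) K) ^ D ∈ (veronese K m D).range :=
  (veronese K m D).mem_range.mpr ⟨X (vidx m D (Finsupp.single k D) (Finsupp.degree_single k D)), by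
    rw [veronese_X, vexp_vidx, X_pow_eq_monomial]⟩

variable {K m D} in
/-- **`ℚ[x]` is integral over the Veronese subring `θ_D(ℚ[y])`** (`x_k` is a root of
`T^D − x_k^D`; `D ≥ 1`). [folklore] -/
theorem isIntegral_veronese_range (hD : 1 ≤ D) (P : MvPolynomial (Fin (m + 1)) K) :
    IsIntegral (veronese K m D).range P := by
  have hX : ∀ k : Fin (m + 1), IsIntegral (veronese K m D).range (X k : MvPolynomial (Fin (m + 1)) K) := by
    intro k
    refine ⟨Polynomial.X ^ D - Polynomial.C ⟨X k ^ D, X_pow_mem_range K m D k⟩,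
      Polynomial.monic_X_pow_sub_C _ (by omega), ?_⟩
    rw [Polynomial.eval₂_sub, Polynomial.eval₂_X_pow, Polynomial.eval₂_C, sub_eq_zero]
    rfl
  induction P using MvPolynomial.induction_on with
  | C a =>
    have hC : (C a : MvPolynomial (Fin (m + 1)) K) ∈ (veronese K m D).range :=
      (veronese K m D).mem_range.mpr ⟨C a, by rw [algHom_C]; rfl⟩
    exact isIntegral_algebraMap (R := (veronese K m D).range) (A := MvPolynomial (Fin (m + 1)) K) (x := ⟨C a, hC⟩)
  | add p q hp hq => exact hp.add hq
  | mul_X p k hp => exact hp.mul (hX k)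

variable {K m D} in
/-- **`dim ℚ[y₀,…,y_N]/𝔙_D = m + 1`**: the quotient is the Veronese subring of `ℚ[x₀,…,x_m]`, over
which `ℚ[x]` is integral. [folklore] -/
theorem ringKrullDim_quot_veroIdeal (hD : 1 ≤ D) :
    ringKrullDim (MvPolynomial (Fin (veroN m D + 1)) K ⧸ veroIdeal K m D) = (m + 1 : ℕ) := by
  have hker : veroIdeal K m D = RingHom.ker (veronese K m D).rangeRestrict := by
    rw [veroIdeal, AlgHom.ker_rangeRestrict]
  have e : (MvPolynomial (Fin (veroN m D + 1)) K ⧸ veroIdeal K m D) ≃+* (veronese K m D).range :=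
    (Ideal.quotEquivOfEq hker).trans
      (Ideal.quotientKerAlgEquivOfSurjective
        (AlgHom.rangeRestrict_surjective (veronese K m D))).toRingEquiv
  rw [ringKrullDim_eq_of_ringEquiv e]
  haveI : Algebra.IsIntegral (veronese K m D).range (MvPolynomial (Fin (m + 1)) K) :=
    ⟨isIntegral_veronese_range hD⟩
  rw [Literature.RingTheory.KrullDimension.ringKrullDim_eq_of_isIntegral
    (R := (veronese K m D).range) (S := MvPolynomial (Fin (m + 1)) K) Subtype.val_injective,
    MvPolynomial.ringKrullDim_of_isNoetherianRing, ringKrullDim_eq_zero_of_field,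
    Nat.card_eq_fintype_card, Fintype.card_fin, zero_add]

variable {K m D} in
/-- **`𝔙_D` is unmixed of rank `m + 1`** (a prime of the right dimension). [folklore] -/
theorem isUnmixedOfRank_veroIdeal (hD : 1 ≤ D) :
    NesterenkoK.IsUnmixedOfRank (veroIdeal K m D) (m + 1) :=
  NesterenkoK.isUnmixedOfRank_of_isPrime (veroIdeal_isPrime K m D) (ringKrullDim_quot_veroIdeal hD)

variable {K} in
/-- A proper prime ideal is its own reduced primary decomposition (as in the tree's
`Literature.Barriers.Schanuel.isMinimalPrimaryDecomposition_singleton`, restated to avoid the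
import). [folklore] -/
theorem isMinimalPrimaryDecomposition_self {n : ℕ} {𝔭 : Ideal (MvPolynomial (Fin (n + 1)) K)}
    (h𝔭 : 𝔭.IsPrime) : Submodule.IsMinimalPrimaryDecomposition 𝔭 {𝔭} where
  inf_eq := by simp
  primary := fun J hJ => by
    rw [Finset.mem_singleton] at hJ
    subst hJ
    exact h𝔭.isPrimary
  distinct := by simp
  minimal := fun J hJ => by
    rw [Finset.mem_singleton] at hJ
    subst hJ
    simp only [Finset.erase_singleton, Finset.inf_empty, top_le_iff]
    exact h𝔭.ne_top

/-! ## `Res_D`: the resultant of `m + 1` forms of degree `D` in `m + 1` variables -/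

/-- **The resultant `Res_D`** of `m + 1` generic forms of degree `D` in `m + 1` variables: the
associated (Chow) form, in the sense of Nesterenko (LNM 1752 Ch. 3 Def. 4.3–4.5), of the Veronese
ideal `𝔙_D` with `r = m + 1` groups of variables `uᵢ = (u_{i,j})_{j ≤ N}` — i.e. the Chow form of
`ℙ^m` in degree `D`. A polynomial in `ℚ[u₁, …, u_{m+1}]`, `u_{i,j}` the coefficient of `x^{α_j}` in
the `i`-th form. [folklore] -/
def resD : MvPolynomial (Fin (m + 1) × Fin (veroN m D + 1)) K := NesterenkoK.chowForm (veroIdeal K m D) (m + 1)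

variable {K m D} in
/-- Proposition 4.4 for the Veronese ideal. [cite: NesterenkoPhilippon2001, Ch. 3 Prop. 4.4 (p. 38)] -/
theorem prop44_veroIdeal [CharZero K] (hm : 1 ≤ m) (hD : 2 ≤ D) :
    (NesterenkoK.elimIdeal (veroIdeal K m D) (m + 1)).IsPrincipal ∧
      (∀ Q ∈ ({veroIdeal K m D} : Finset _), (NesterenkoK.elimIdeal Q.radical (m + 1)).IsPrincipal) ∧
      (∀ F : Ideal (MvPolynomial (Fin (veroN m D + 1)) K) → MvPolynomial (Fin (m + 1) × Fin (veroN m D + 1)) K,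
        (∀ Q ∈ ({veroIdeal K m D} : Finset _),
          Ideal.span {F Q} = NesterenkoK.elimIdeal Q.radical (m + 1)) →
        (∀ Q ∈ ({veroIdeal K m D} : Finset _), Irreducible (F Q)) ∧
        Ideal.span {∏ Q ∈ ({veroIdeal K m D} : Finset _), F Q ^ NesterenkoK.primaryExponent Q} =
          NesterenkoK.elimIdeal (veroIdeal K m D) (m + 1)) ∧
      (∀ i : Fin (m + 1), NesterenkoK.blockDeg (NesterenkoK.chowForm (veroIdeal K m D) (m + 1)) i =
        NesterenkoK.ideg (veroIdeal K m D) (m + 1)) :=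
  NesterenkoK.prop_4_4 (veroN m D) (m + 1) (veroIdeal K m D) (by omega)
    (succ_le_veroN hm hD) (veroIdeal_isHomogeneous (by omega)) (isUnmixedOfRank_veroIdeal (by omega))
    {veroIdeal K m D} (isMinimalPrimaryDecomposition_self (veroIdeal_isPrime K m D))

variable {K m D} in
/-- The ideal of inertia forms of `𝔙_D` with `m + 1` hyperplanes is principal.
[cite: NesterenkoPhilippon2001, Ch. 3 Prop. 4.4 (p. 38)] -/
theorem isPrincipal_elimIdeal_veroIdeal [CharZero K] (hm : 1 ≤ m) (hD : 2 ≤ D) :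
    (NesterenkoK.elimIdeal (veroIdeal K m D) (m + 1)).IsPrincipal :=
  (prop44_veroIdeal (K := K) hm hD).1

variable {K m D} in
/-- **`(Res_D)` is the ideal of inertia forms of the Veronese ideal.**
[cite: NesterenkoPhilippon2001, Ch. 3 Prop. 4.4 (p. 38)] -/
theorem span_resD [CharZero K] (hm : 1 ≤ m) (hD : 2 ≤ D) :
    Ideal.span {resD K m D} = NesterenkoK.elimIdeal (veroIdeal K m D) (m + 1) :=
  NesterenkoK.span_chowForm _ _ (isPrincipal_elimIdeal_veroIdeal hm hD)

variable {K m D} in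
/-- **`Res_D` is irreducible** over `K`. [cite: NesterenkoPhilippon2001, Ch. 3 Prop. 4.4 (p. 38)] -/
theorem irreducible_resD [CharZero K] (hm : 1 ≤ m) (hD : 2 ≤ D) : Irreducible (resD K m D) := by
  obtain ⟨-, -, hF, -⟩ := prop44_veroIdeal (K := K) hm hD
  have h := (hF (fun _ => resD K m D) (fun Q hQ => by
    rw [Finset.mem_singleton] at hQ
    subst hQ
    rw [(veroIdeal_isPrime K m D).radical]
    exact span_resD hm hD)).1 (veroIdeal K m D) (Finset.mem_singleton_self _)
  exact h

variable {K m D} in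
/-- `Res_D ≠ 0`. [folklore] -/
theorem resD_ne_zero [CharZero K] (hm : 1 ≤ m) (hD : 2 ≤ D) : resD K m D ≠ 0 := (irreducible_resD (K := K) hm hD).ne_zero

variable {K m D} in
/-- **`Res_D` is multihomogeneous of the same degree `deg 𝔙_D` in each group `uᵢ`.**
[cite: NesterenkoPhilippon2001, Ch. 3 Prop. 4.4 (p. 38)] -/
theorem blockDeg_resD [CharZero K] (hm : 1 ≤ m) (hD : 2 ≤ D) (i : Fin (m + 1)) :
    NesterenkoK.blockDeg (resD K m D) i = NesterenkoK.ideg (veroIdeal K m D) (m + 1) :=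
  (prop44_veroIdeal (K := K) hm hD).2.2.2 i

variable {K m D} in
/-- **The zeros of `Res_D`**: for `u = (u_{i,j}) ∈ L^{(m+1)(N+1)}`, `Res_D(u) = 0` iff the `m + 1`
forms `Pᵢ = ∑_j u_{i,j} x^{α_j}` of degree `D` have a common zero in `ℙ^m(L)` (`m ≥ 1`, `D ≥ 2`):
Nesterenko's zeros theorem for the associated form of `𝔙_D` combined with
`V(𝔙_D) = v_D(ℙ^m)`. [cite: NesterenkoPhilippon2001, Ch. 3 Prop. 4.4 (p. 38)] -/
theorem aeval_resD_eq_zero_iff [CharZero K] [IsAlgClosed L] (hm : 1 ≤ m) (hD : 2 ≤ D)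
    (u : Fin (m + 1) × Fin (veroN m D + 1) → L) :
    aeval u (resD K m D) = 0 ↔
      ∃ x : Fin (m + 1) → L, x ≠ 0 ∧ ∀ i : Fin (m + 1), ∑ j, u (i, j) * veroPt m D x j = 0 := by
  rw [NesterenkoK.aeval_generator_eq_zero_iff (L := L) (veroIdeal_isHomogeneous (by omega))
    (span_resD hm hD) u]
  constructor
  · rintro ⟨y, hy0, hyI, hu⟩
    obtain ⟨x, hx, c, hc, hcy⟩ := exists_veroPt_of_zeros (by omega) hy0 hyI
    refine ⟨x, hx, fun i => ?_⟩
    rw [← hcy]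
    calc ∑ j, u (i, j) * (c • y) j = c * ∑ j, u (i, j) * y j := by
          rw [Finset.mul_sum]
          refine Finset.sum_congr rfl fun j _ => ?_
          rw [Pi.smul_apply, smul_eq_mul]
          ring
      _ = 0 := by rw [hu i, mul_zero]
  · rintro ⟨x, hx, hu⟩
    exact ⟨veroPt m D x, veroPt_ne_zero hx, fun P hP => aeval_veroPt_eq_zero x hP, hu⟩


end Veronese

/-! ## The degree of `Res_D`: the lower bound `D^m ≤ deg 𝔙_D` -/

section DegreeLowerBound

variable {L : Type*} [Field L] [Algebra K L]

variable {K} in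
/-- Monomials in the support contribute at most `blockDeg` in each block. [folklore] -/
theorem sum_le_blockDeg' {r N : ℕ} {G : MvPolynomial (Fin r × Fin (N + 1)) K} {e : Fin r × Fin (N + 1) →₀ ℕ}
    (he : e ∈ G.support) (i : Fin r) : ∑ j, e (i, j) ≤ NesterenkoK.blockDeg G i :=
  Finset.le_sup (f := fun e : Fin r × Fin (N + 1) →₀ ℕ => ∑ j : Fin (N + 1), e (i, j)) he

/-- **Degree of a one-block pencil specialisation**: if the variables of block `i` are sent to
polynomials of degree `≤ 1` in `t` and all other variables to constants, the specialisation of `G`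
has degree `≤ deg_{uᵢ} G` in `t`. [folklore] -/
theorem natDegree_aeval_le_blockDeg {K : Type*} [Field K] {r N : ℕ} (G : MvPolynomial (Fin r × Fin (N + 1)) K) (i : Fin r)
    (g : Fin r × Fin (N + 1) → Polynomial K) (hg1 : ∀ j, (g (i, j)).natDegree ≤ 1)
    (hg0 : ∀ v, v.1 ≠ i → (g v).natDegree = 0) :
    (aeval g G).natDegree ≤ NesterenkoK.blockDeg G i := by
  classical
  rw [MvPolynomial.aeval_def, MvPolynomial.eval₂_eq]
  refine Polynomial.natDegree_sum_le_of_forall_le _ _ fun e he => ?_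
  refine Polynomial.natDegree_mul_le.trans ?_
  rw [show ((algebraMap K (Polynomial K)) (coeff e G)).natDegree = 0 from Polynomial.natDegree_C _,
    zero_add]
  refine (Polynomial.natDegree_prod_le _ _).trans ?_
  calc ∑ v ∈ e.support, (g v ^ e v).natDegree
      ≤ ∑ v ∈ e.support, (if v.1 = i then e v else 0) := by
        refine Finset.sum_le_sum fun v _ => ?_
        refine Polynomial.natDegree_pow_le.trans ?_
        split_ifs with hv
        · calc e v * (g v).natDegree ≤ e v * 1 := by
                refine Nat.mul_le_mul_left _ ?_
                obtain ⟨i', j⟩ := v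
                simp only at hv
                subst hv
                exact hg1 j
            _ = e v := mul_one _
        · rw [hg0 v hv, mul_zero]
    _ = ∑ v ∈ e.support.filter (fun v => v.1 = i), e v := (Finset.sum_filter _ _).symm
    _ ≤ ∑ v ∈ (Finset.univ : Finset (Fin (N + 1))).map
          ⟨fun j => (i, j), fun a b h => (Prod.mk.inj h).2⟩, e v := by
        refine Finset.sum_le_sum_of_subset_of_nonneg ?_ fun _ _ _ => Nat.zero_le _
        intro v hv
        rw [Finset.mem_filter] at hv
        rw [Finset.mem_map]
        refine ⟨v.2, Finset.mem_univ _, ?_⟩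
        obtain ⟨a, b⟩ := v
        simp only at hv
        rw [← hv.2]
        rfl
    _ = ∑ j, e (i, j) := by rw [Finset.sum_map]; rfl
    _ ≤ NesterenkoK.blockDeg G i := sum_le_blockDeg' he i

/-- Evaluating a pencil specialisation at `t = τ`. [folklore] -/
theorem eval_aeval_eq {K : Type*} [Field K] {σ : Type*} (g : σ → Polynomial K) (G : MvPolynomial σ K) (τ : K) :
    (aeval g G).eval τ = aeval (fun v => (g v).eval τ) G := by
  rw [← Polynomial.coe_aeval_eq_eval, ← AlgHom.comp_apply, MvPolynomial.comp_aeval]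


/-- A form of degree `D` evaluated at `x` is `∑_j [x^{α_j}]P · x^{α_j}`. [folklore] -/
theorem aeval_eq_sum_coeff_mul_veroPt {P : MvPolynomial (Fin (m + 1)) K} (hP : P.IsHomogeneous D)
    (x : Fin (m + 1) → L) :
    aeval x P = ∑ j, algebraMap K L (coeff (vexp m D j) P) * veroPt m D x j := by
  classical
  set f : (Fin (m + 1) →₀ ℕ) → L := fun d => algebraMap K L (coeff d P) * ∏ k, x k ^ d k with hf
  have h1 : aeval x P = ∑ d ∈ P.support, f d := by
    rw [MvPolynomial.aeval_def, MvPolynomial.eval₂_eq]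
    refine Finset.sum_congr rfl fun d _ => ?_
    simp only [hf]
    congr 1
    exact Finsupp.prod_fintype d (fun k e => x k ^ e) fun k => pow_zero (x k)
  have h2 : ∑ j, algebraMap K L (coeff (vexp m D j) P) * veroPt m D x j =
      ∑ d ∈ (Finset.univ : Finset (Fin (veroN m D + 1))).image (vexp m D), f d := by
    rw [Finset.sum_image fun a _ b _ h => vexp_injective m D h]
    simp only [hf]
    rfl
  rw [h1, h2]
  refine Finset.sum_subset ?_ ?_
  · intro d hd
    rw [Finset.mem_image]
    exact ⟨vidx m D d (degree_eq_of_mem_support hP hd), Finset.mem_univ _, vexp_vidx m D _ _⟩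
  · intro d _ hd
    simp only [hf]
    rw [notMem_support_iff.mp hd, map_zero, zero_mul]

/-! ### The special forms `∏_{j<D}(x_i − j x_m)`, `(∑ D^i x_i) x_m^{D−1}`, `x_m^D` -/

/-- `∏_{j<D} (x_i − j x_m)`: a form of degree `D` splitting into rational linear factors. [folklore] -/
def splitForm (i : Fin (m + 1)) : MvPolynomial (Fin (m + 1)) K :=
  ∏ j ∈ Finset.range D, (X i - C (j : K) * X (Fin.last m))

/-- `splitForm` is a form of degree `D`. [folklore] -/
theorem isHomogeneous_splitForm (i : Fin (m + 1)) : (splitForm K m D i).IsHomogeneous D := by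
  have h : (splitForm K m D i).IsHomogeneous (∑ _j ∈ Finset.range D, 1) := by
    refine IsHomogeneous.prod _ _ _ fun j _ => ?_
    refine (isHomogeneous_X K i).sub ?_
    simpa using (isHomogeneous_C (Fin (m + 1)) (j : K)).mul (isHomogeneous_X K (Fin.last m))
  simpa using h

/-- `splitForm i (x) = ∏_{j<D} (x_i − j x_m)`. [folklore] -/
theorem aeval_splitForm (i : Fin (m + 1)) (x : Fin (m + 1) → L) :
    aeval x (splitForm K m D i) = ∏ j ∈ Finset.range D, (x i - (j : L) * x (Fin.last m)) := by
  simp [splitForm, map_prod]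

/-- `A = (∑_{i<m} D^i x_i) · x_m^{D−1}`. [folklore] -/
def pencilA : MvPolynomial (Fin (m + 1)) K :=
  (∑ i : Fin m, C ((D : K) ^ (i : ℕ)) * X (Fin.castSucc i)) * X (Fin.last m) ^ (D - 1)

/-- `B = x_m^D`. [folklore] -/
def pencilB : MvPolynomial (Fin (m + 1)) K := X (Fin.last m) ^ D

variable {K m D} in
/-- `A` is a form of degree `D` (`D ≥ 1`). [folklore] -/
theorem isHomogeneous_pencilA (hD : 1 ≤ D) : (pencilA K m D).IsHomogeneous D := by
  have h1 : (∑ i : Fin m, C ((D : K) ^ (i : ℕ)) * X (Fin.castSucc i) : MvPolynomial (Fin (m + 1)) K).IsHomogeneous 1 := by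
    refine IsHomogeneous.sum _ _ _ fun i _ => ?_
    simpa using (isHomogeneous_C (Fin (m + 1)) ((D : K) ^ (i : ℕ))).mul
      (isHomogeneous_X K (Fin.castSucc i))
  have h := h1.mul (isHomogeneous_X_pow (R := K) (Fin.last m) (D - 1))
  rwa [show 1 + (D - 1) = D by omega] at h

/-- `B` is a form of degree `D`. [folklore] -/
theorem isHomogeneous_pencilB : (pencilB K m D).IsHomogeneous D := isHomogeneous_X_pow _ _

/-- `A(x) = (∑ D^i x_i) x_m^{D−1}`. [folklore] -/
theorem aeval_pencilA (x : Fin (m + 1) → L) :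
    aeval x (pencilA K m D) =
      (∑ i : Fin m, (D : L) ^ (i : ℕ) * x (Fin.castSucc i)) * x (Fin.last m) ^ (D - 1) := by
  simp [pencilA, map_sum]

/-- `B(x) = x_m^D`. [folklore] -/
theorem aeval_pencilB (x : Fin (m + 1) → L) : aeval x (pencilB K m D) = x (Fin.last m) ^ D := by
  simp [pencilB]

/-- The forms of the specialisation at `t = τ`: `Q_i = splitForm i` for `i < m` and
`Q_m = A − τ B`. [folklore] -/
def pencilForm (τ : K) (i : Fin (m + 1)) : MvPolynomial (Fin (m + 1)) K :=
  if i = Fin.last m then pencilA K m D - C τ * pencilB K m D else splitForm K m D i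

variable {K m D} in
/-- Each `Q_i` is a form of degree `D`. [folklore] -/
theorem isHomogeneous_pencilForm (hD : 1 ≤ D) (τ : K) (i : Fin (m + 1)) :
    (pencilForm K m D τ i).IsHomogeneous D := by
  unfold pencilForm
  split_ifs
  · refine (isHomogeneous_pencilA hD).sub ?_
    simpa using (isHomogeneous_C (Fin (m + 1)) τ).mul (isHomogeneous_pencilB K m D)
  · exact isHomogeneous_splitForm K m D i

/-- **The pencil specialisation** of the generic coefficients: `u_{i,j} ↦ [x^{α_j}] splitForm i`
for `i < m`, `u_{m,j} ↦ [x^{α_j}]A − [x^{α_j}]B · t`. [folklore] -/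
def pencilSpec (v : Fin (m + 1) × Fin (veroN m D + 1)) : Polynomial K :=
  if v.1 = Fin.last m then
    Polynomial.C (coeff (vexp m D v.2) (pencilA K m D)) -
      Polynomial.C (coeff (vexp m D v.2) (pencilB K m D)) * Polynomial.X
  else Polynomial.C (coeff (vexp m D v.2) (splitForm K m D v.1))

/-- `f(t) = Res_D(splitForm₀, …, splitForm_{m−1}, A − tB) ∈ ℚ[t]`. [folklore] -/
def pencilPoly : Polynomial K := aeval (pencilSpec K m D) (resD K m D)

variable {K m D} in
/-- **`deg f ≤ deg_{u_m} Res_D = deg 𝔙_D`.** [folklore] -/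
theorem natDegree_pencilPoly_le [CharZero K] (hm : 1 ≤ m) (hD : 2 ≤ D) :
    (pencilPoly K m D).natDegree ≤ NesterenkoK.ideg (veroIdeal K m D) (m + 1) := by
  rw [← blockDeg_resD (K := K) hm hD (Fin.last m), pencilPoly]
  refine natDegree_aeval_le_blockDeg _ _ _ (fun j => ?_) (fun v hv => ?_)
  · rw [pencilSpec, if_pos rfl]
    refine (Polynomial.natDegree_sub_le _ _).trans ?_
    rw [Polynomial.natDegree_C, Nat.zero_max]
    refine Polynomial.natDegree_mul_le.trans ?_
    rw [Polynomial.natDegree_C, zero_add]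
    exact Polynomial.natDegree_X_le
  · rw [pencilSpec, if_neg hv, Polynomial.natDegree_C]

/-- The specialisation at `t = τ` is the coefficient vector of the forms `Q_i`. [folklore] -/
theorem eval_pencilSpec (τ : K) (v : Fin (m + 1) × Fin (veroN m D + 1)) :
    (pencilSpec K m D v).eval τ = coeff (vexp m D v.2) (pencilForm K m D τ v.1) := by
  unfold pencilSpec pencilForm
  split_ifs with h
  · simp only [Polynomial.eval_sub, Polynomial.eval_C, Polynomial.eval_mul, Polynomial.eval_X,
      coeff_sub, coeff_C_mul]
    ring
  · rw [Polynomial.eval_C]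

variable {K m D} in
/-- **`f(τ) = 0` iff the forms `splitForm₀, …, splitForm_{m−1}, A − τB` have a common zero in
`ℙ^m(L)`** (the zeros theorem for `Res_D`). [folklore] -/
theorem eval_pencilPoly_eq_zero_iff [CharZero K] [IsAlgClosed L] (hm : 1 ≤ m) (hD : 2 ≤ D) (τ : K) :
    (pencilPoly K m D).eval τ = 0 ↔
      ∃ x : Fin (m + 1) → L, x ≠ 0 ∧ ∀ i, aeval x (pencilForm K m D τ i) = 0 := by
  have hcast : algebraMap K L ((pencilPoly K m D).eval τ) =
      aeval (fun v => algebraMap K L (coeff (vexp m D v.2) (pencilForm K m D τ v.1))) (resD K m D) := by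
    rw [pencilPoly, eval_aeval_eq]
    simp_rw [eval_pencilSpec]
    rw [show (fun v : Fin (m + 1) × Fin (veroN m D + 1) =>
        algebraMap K L (coeff (vexp m D v.2) (pencilForm K m D τ v.1))) =
        algebraMap K L ∘ fun v => coeff (vexp m D v.2) (pencilForm K m D τ v.1) from rfl,
      MvPolynomial.aeval_algebraMap_apply]
  rw [← map_eq_zero_iff (algebraMap K L) (algebraMap K L).injective, hcast,
    aeval_resD_eq_zero_iff hm hD]
  refine exists_congr fun x => and_congr_right fun _ => forall_congr' fun i => ?_
  dsimp only
  rw [aeval_eq_sum_coeff_mul_veroPt K m D (isHomogeneous_pencilForm (by omega) τ i) x]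

/-! ### The roots of `f` -/

variable {K m D} in
/-- **`f(n) = 0` for every `n = ∑ D^i j_i` with digits `j_i < D`**: the point
`(j₀, …, j_{m−1}, 1)` is a common zero. [folklore] -/
theorem eval_pencilPoly_digits [CharZero K] (hm : 1 ≤ m) (hD : 2 ≤ D) (j : Fin m → ℕ)
    (hj : ∀ i, j i < D) :
    (pencilPoly K m D).eval (∑ i : Fin m, (D : K) ^ (i : ℕ) * j i) = 0 := by
  let L := AlgebraicClosure K
  rw [eval_pencilPoly_eq_zero_iff (L := L) hm hD]
  refine ⟨Fin.snoc (fun i => (j i : L)) 1, ?_, fun i => ?_⟩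
  · intro h
    have := congrFun h (Fin.last m)
    rw [Fin.snoc_last, Pi.zero_apply] at this
    exact one_ne_zero this
  · unfold pencilForm
    split_ifs with hi
    · rw [map_sub, map_mul, aeval_C, aeval_pencilA, aeval_pencilB]
      simp only [Fin.snoc_last, Fin.snoc_castSucc, one_pow, mul_one, map_sum, map_mul, map_pow,
        map_natCast]
      ring
    · obtain ⟨i', rfl⟩ := Fin.exists_castSucc_eq.mpr hi
      rw [aeval_splitForm]
      refine Finset.prod_eq_zero (Finset.mem_range.mpr (hj i')) ?_
      simp

variable {K m D} in
/-- **`f(−1) ≠ 0`**: the forms `splitForm_i` and `A + B` have no common zero (a common zero has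
`x_m ≠ 0`, `x_i = j_i x_m` with `j_i < D`, and then `(A + B)(x) = x_m^D (∑ D^i j_i + 1) ≠ 0`).
[folklore] -/
theorem eval_pencilPoly_neg_one_ne_zero [CharZero K] (hm : 1 ≤ m) (hD : 2 ≤ D) :
    (pencilPoly K m D).eval (-1) ≠ 0 := by
  let L := AlgebraicClosure K
  rw [Ne, eval_pencilPoly_eq_zero_iff (L := L) hm hD]
  rintro ⟨x, hx0, hx⟩
  -- digits
  have hdig : ∀ i : Fin m, ∃ j : ℕ, j < D ∧ x (Fin.castSucc i) = (j : L) * x (Fin.last m) := by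
    intro i
    have h := hx (Fin.castSucc i)
    rw [pencilForm, if_neg (Fin.castSucc_lt_last i).ne, aeval_splitForm,
      Finset.prod_eq_zero_iff] at h
    obtain ⟨j, hj, h⟩ := h
    exact ⟨j, Finset.mem_range.mp hj, sub_eq_zero.mp h⟩
  choose j hj hxj using hdig
  -- `x_m ≠ 0`
  have hxm : x (Fin.last m) ≠ 0 := by
    intro h0
    apply hx0
    funext k
    induction k using Fin.lastCases with
    | last => exact h0
    | cast i => rw [hxj i, h0, mul_zero]; rfl
  -- the pencil form at `τ = −1`
  have h := hx (Fin.last m)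
  rw [pencilForm, if_pos rfl, map_sub, map_mul, aeval_C, aeval_pencilA, aeval_pencilB] at h
  simp_rw [hxj] at h
  have hS : ∑ i : Fin m, (D : L) ^ (i : ℕ) * ((j i : L) * x (Fin.last m)) =
      (∑ i : Fin m, (D : L) ^ (i : ℕ) * (j i : L)) * x (Fin.last m) := by
    rw [Finset.sum_mul]
    exact Finset.sum_congr rfl fun i _ => by ring
  have e : x (Fin.last m) ^ D = x (Fin.last m) * x (Fin.last m) ^ (D - 1) := by
    rw [← pow_succ', Nat.sub_add_cancel (by omega)]
  rw [hS, map_neg, map_one, e] at h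
  have key : (∑ i : Fin m, (D : L) ^ (i : ℕ) * (j i : L)) * x (Fin.last m) *
        x (Fin.last m) ^ (D - 1) - (-1) * (x (Fin.last m) * x (Fin.last m) ^ (D - 1)) =
      ((∑ i : Fin m, (D : L) ^ (i : ℕ) * (j i : L)) + 1) * (x (Fin.last m) * x (Fin.last m) ^ (D - 1)) := by
    ring
  have hpos : (∑ i : Fin m, (D : L) ^ (i : ℕ) * (j i : L)) + 1 ≠ 0 := by
    have h1 : ((∑ i : Fin m, D ^ (i : ℕ) * j i + 1 : ℕ) : L) ≠ 0 := Nat.cast_ne_zero.mpr (by omega)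
    have h2 : ((∑ i : Fin m, D ^ (i : ℕ) * j i + 1 : ℕ) : L) =
        (∑ i : Fin m, (D : L) ^ (i : ℕ) * (j i : L)) + 1 := by
      rw [Nat.cast_add, Nat.cast_one, Nat.cast_sum]
      simp only [Nat.cast_mul, Nat.cast_pow]
    rw [h2] at h1
    exact h1
  rw [key, mul_eq_zero, ← e] at h
  rcases h with h | h
  · exact hpos h
  · exact hxm (pow_eq_zero_iff (by omega) |>.mp h)

variable {K m D} in
/-- **The lower bound `D^m ≤ deg 𝔙_D`** (`m ≥ 1`, `D ≥ 2`): the pencil polynomial `f` is non-zero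
(`f(−1) ≠ 0`), has degree `≤ deg 𝔙_D`, and vanishes at the `D^m` integers `0, 1, …, D^m − 1`.
[folklore] -/
theorem pow_le_ideg_veroIdeal [CharZero K] (hm : 1 ≤ m) (hD : 2 ≤ D) :
    D ^ m ≤ NesterenkoK.ideg (veroIdeal K m D) (m + 1) := by
  classical
  set f := pencilPoly K m D with hf
  have hf0 : f ≠ 0 := fun h =>
    eval_pencilPoly_neg_one_ne_zero (K := K) hm hD (by rw [← hf, h, Polynomial.eval_zero])
  -- the `D^m` distinct roots
  have hroots : (Finset.range (D ^ m)).image (fun n : ℕ => (n : K)) ⊆ f.roots.toFinset := by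
    intro q hq
    obtain ⟨n, hn, rfl⟩ := Finset.mem_image.mp hq
    obtain ⟨j, hj, hsum⟩ := exists_digits (by omega : 1 ≤ D) m n (Finset.mem_range.mp hn)
    rw [Multiset.mem_toFinset, Polynomial.mem_roots hf0, Polynomial.IsRoot.def, ← hsum]
    push_cast
    exact eval_pencilPoly_digits (K := K) hm hD j hj
  have hcard : ((Finset.range (D ^ m)).image (fun n : ℕ => (n : K))).card = D ^ m := by
    rw [Finset.card_image_of_injective _ Nat.cast_injective, Finset.card_range]
  calc D ^ m = ((Finset.range (D ^ m)).image (fun n : ℕ => (n : K))).card := hcard.symm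
    _ ≤ f.roots.toFinset.card := Finset.card_le_card hroots
    _ ≤ Multiset.card f.roots := Multiset.toFinset_card_le _
    _ ≤ f.natDegree := Polynomial.card_roots' f
    _ ≤ NesterenkoK.ideg (veroIdeal K m D) (m + 1) := natDegree_pencilPoly_le (K := K) hm hD

end DegreeLowerBound

end NguyenRoyK

end Literature.NumberTheory.Transcendental
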